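import Mathlib
import Summits.MatrixMultiplication.MatrixMultiplication.Theses.LevelGradedCohnUmans
import Summits.MatrixMultiplication.MatrixMultiplication.Theorems.SnLevelDesigns.Negative.DimensionWalls
import Summits.MatrixMultiplication.MatrixMultiplication.Theorems.LevelGradedCohnUmansTokenWall

/-!
# `SnLevelDesigns` (stmt-MatrixMultiplication-7613), line `garnir-annihilator`:
# K5 `stub_alphabetWall` — the pair wall on a support

Crux `Summit.MatrixMultiplication.MatrixMultiplication.Theses.LevelGradedCohnUmans.SnLevelDesigns`;
skeleton `Cruxes/SnLevelDesigns/Lines/garnir_annihilator.lean` (lead c3 reshape 7, registered stub K5);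
this file proves the registered stub `stub_alphabetWall` verbatim and lands
`--supports stmt-MatrixMultiplication-7613`.

Statement: if `X, Y ⊆ 𝔖ₙ` consist of permutations fixing every point `≥ n'`, `Z ≠ ∅` and `(X, Y, Z)` is
`k`-token separated in `𝔖ₙ`, then `|X|·|Y| ≤ D_k(n') := ∑_{μ ⊢ n', μ₁ ≥ n' - k} (f^μ)²`, the level-`k`
dimension of the SMALL symmetric group `𝔖_{n'}`.

Proof.  Let `ι : 𝔖_m → 𝔖_N` (`m ≤ N`) be extension by the identity (`aw_exists_emb`: its values on and
off the initial segment `[0, m)`, and every permutation fixing all points `≥ m` is in its image).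
* `aw_pullback` (`0 < m`): a `k`-token function of `𝔖_N` pulled back along `ι` is a `k`-token function
  of `𝔖_m` — a token sitting at a point `≥ m` reads a constant; re-index the table, sending the idle
  coordinates to a dummy letter.
* `aw_pushforward`: a `k`-token function of `𝔖_m` is the pullback along `ι` of a `k`-token function of
  `𝔖_N` (extend the table by zero).
* `aw_core` (the landed wall `Negative.card_X_mul_card_Y_le_finrank`, abstracted): if the right
  translates `w ↦ f_{x₀,z₁}(w · y⁻¹ z₁)` of the separators of one column `z₁ ∈ Z`, which are dual to the
  points `x⁻¹ y''` (`x ∈ X`, `y'' ∈ Y`), can be transported to `k`-token functions of `𝔖_{n'}` together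
  with their points, then `|X|·|Y| ≤ dim T_k(𝔖_{n'})` (`Negative.linearIndependent_of_dualPoints`).
* `0 < n' ≤ n`: the points `x⁻¹ y''` fix every point `≥ n'`, so they are `ι` of permutations of
  `Fin n'`, and the functions pull back (`aw_pullback`).  `n ≤ n'`: push everything forward
  (`aw_pushforward`).  `n' = 0`: `X, Y ⊆ {1}` and `D_k(0) = (f^∅)² ≥ 1`.
Finally `dim T_k(𝔖_{n'}) ≤ D_k(n')` is `LevelGradedCohnUmansTokenWall.finrank_tokenSpace_le`.
-/

set_option linter.dupNamespace false

namespace Summit.MatrixMultiplication.MatrixMultiplication.Theorems.SnLevelDesigns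

open scoped BigOperators
open Summit.MatrixMultiplication.MatrixMultiplication.Theorems.SnLevelDesigns.Negative
open Literature.NumberTheory.DiophantineGeometry

/-- **Extension by the identity** `ι : 𝔖_m → 𝔖_N` (`m ≤ N`): there is a map `ι` such that `ι g` acts
by `g` on the initial segment `[0, m)` and fixes every point `≥ m`, and every permutation of `Fin N`
fixing all points `≥ m` is `ι` of a permutation of `Fin m`
(`Equiv.Perm.ofSubtype` / `Equiv.Perm.subtypePerm` transported along `Fin m ≃ {b : Fin N // b < m}`). -/
theorem aw_exists_emb {m N : ℕ} (h : m ≤ N) :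
    ∃ ι : Equiv.Perm (Fin m) → Equiv.Perm (Fin N),
      (∀ (g : Equiv.Perm (Fin m)) (b : Fin N) (hb : (b : ℕ) < m),
          ι g b = ⟨g ⟨b, hb⟩, lt_of_lt_of_le (g ⟨b, hb⟩).2 h⟩) ∧
        (∀ (g : Equiv.Perm (Fin m)) (b : Fin N), ¬ (b : ℕ) < m → ι g b = b) ∧
          ∀ g : Equiv.Perm (Fin N), (∀ b : Fin N, m ≤ (b : ℕ) → g b = b) →
            ∃ g' : Equiv.Perm (Fin m), ι g' = g := by
  -- the initial segment `Fin m` of `Fin N` as a subtype of `Fin N`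
  let e : Fin m ≃ {b : Fin N // (b : ℕ) < m} :=
    { toFun := fun i => ⟨⟨i, lt_of_lt_of_le i.2 h⟩, i.2⟩
      invFun := fun b => ⟨b.1, b.2⟩
      left_inv := fun _ => rfl
      right_inv := fun _ => rfl }
  refine ⟨fun g => Equiv.Perm.ofSubtype (e.permCongr g), fun g b hb => ?_, fun g b hb => ?_,
    fun g hg => ?_⟩
  · show Equiv.Perm.ofSubtype (e.permCongr g) b = _
    rw [Equiv.Perm.ofSubtype_apply_of_mem (p := fun b : Fin N => (b : ℕ) < m) (a := b) _ hb,
      Equiv.permCongr_apply]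
    rfl
  · show Equiv.Perm.ofSubtype (e.permCongr g) b = b
    exact Equiv.Perm.ofSubtype_apply_of_not_mem (p := fun b : Fin N => (b : ℕ) < m) (a := b) _ hb
  · have h₁ : ∀ b : Fin N, ((g b : Fin N) : ℕ) < m ↔ (b : ℕ) < m := by
      intro b
      constructor
      · intro hgb
        by_contra hb
        rw [hg b (not_lt.mp hb)] at hgb
        exact hb hgb
      · intro hb
        by_contra hgb
        have h2 : g b = b := g.injective (hg (g b) (not_lt.mp hgb))
        rw [h2] at hgb
        exact hgb hb
    have h₂ : ∀ b : Fin N, g b ≠ b → (b : ℕ) < m := fun b hb =>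
      not_le.mp fun hb' => hb (hg b hb')
    refine ⟨e.permCongr.symm (g.subtypePerm (p := fun b : Fin N => (b : ℕ) < m) h₁), ?_⟩
    show Equiv.Perm.ofSubtype (e.permCongr (e.permCongr.symm _)) = g
    rw [Equiv.apply_symm_apply]
    exact Equiv.Perm.ofSubtype_subtypePerm (p := fun b : Fin N => (b : ℕ) < m) h₁ h₂

/-- **Pullback of token functions** (`0 < m ≤ N`, `ι` = extension by the identity): for every
coefficient table `c` on `k`-tuples of `Fin N` there is a table `c'` on `k`-tuples of `Fin m` with
`f_c (ι g) = f_{c'} (g)` for all `g ∈ 𝔖_m`: `c' p' q' = ∑_{p : res p = p'} c p (merge p q')`, where `res`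
restricts a tuple to the initial segment (letters `≥ m` become the dummy letter `0`) and `merge p q'`
overwrites the small coordinates of `p` by `q'` (a token at a point `≥ m` reads a constant). -/
theorem aw_pullback {m N k : ℕ} (h : m ≤ N) (hm : 0 < m) (ι : Equiv.Perm (Fin m) → Equiv.Perm (Fin N))
    (hlt : ∀ (g : Equiv.Perm (Fin m)) (b : Fin N) (hb : (b : ℕ) < m),
      ι g b = ⟨g ⟨b, hb⟩, lt_of_lt_of_le (g ⟨b, hb⟩).2 h⟩)
    (hge : ∀ (g : Equiv.Perm (Fin m)) (b : Fin N), ¬ (b : ℕ) < m → ι g b = b)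
    (c : (Fin k → Fin N) → (Fin k → Fin N) → ℂ) :
    ∃ c' : (Fin k → Fin m) → (Fin k → Fin m) → ℂ,
      ∀ g : Equiv.Perm (Fin m), tokenFn c (ι g) = tokenFn c' g := by
  -- restriction to the initial segment (dummy letter `⟨0, hm⟩` off it) and merge
  let res : (Fin k → Fin N) → Fin k → Fin m := fun p i =>
    if hi : ((p i : Fin N) : ℕ) < m then ⟨p i, hi⟩ else ⟨0, hm⟩
  let mer : (Fin k → Fin N) → (Fin k → Fin m) → Fin k → Fin N := fun p q i =>
    if ((p i : Fin N) : ℕ) < m then ⟨q i, lt_of_lt_of_le (q i).2 h⟩ else p i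
  refine ⟨fun p' q' => ∑ p : Fin k → Fin N, if res p = p' then c p (mer p q') else 0, fun g => ?_⟩
  have key : ∀ p : Fin k → Fin N, mer p (⇑g ∘ res p) = ⇑(ι g) ∘ p := by
    intro p
    funext i
    apply Fin.ext
    by_cases hi : ((p i : Fin N) : ℕ) < m
    · simp only [mer, res, Function.comp_apply, if_pos hi, dif_pos hi, hlt g (p i) hi]
    · simp only [mer, res, Function.comp_apply, if_neg hi, hge g (p i) hi]
  simp only [tokenFn]
  symm
  rw [Finset.sum_comm]
  refine Finset.sum_congr rfl fun p _ => ?_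
  rw [Finset.sum_ite_eq, if_pos (Finset.mem_univ _), key]

/-- **Pushforward of token functions** (`m ≤ N`, `ι` = extension by the identity on `[0, m)`): every
`k`-token function of `𝔖_m` is the pullback along `ι` of a `k`-token function of `𝔖_N` (extend the
table by zero off the tuples of small letters). -/
theorem aw_pushforward {m N k : ℕ} (h : m ≤ N) (ι : Equiv.Perm (Fin m) → Equiv.Perm (Fin N))
    (hlt : ∀ (g : Equiv.Perm (Fin m)) (b : Fin N) (hb : (b : ℕ) < m),
      ι g b = ⟨g ⟨b, hb⟩, lt_of_lt_of_le (g ⟨b, hb⟩).2 h⟩)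
    (c : (Fin k → Fin m) → (Fin k → Fin m) → ℂ) :
    ∃ c' : (Fin k → Fin N) → (Fin k → Fin N) → ℂ,
      ∀ g : Equiv.Perm (Fin m), tokenFn c' (ι g) = tokenFn c g := by
  -- a tuple of small letters as a tuple of letters of `Fin N`
  let up : (Fin k → Fin m) → Fin k → Fin N := fun p i => ⟨p i, lt_of_lt_of_le (p i).2 h⟩
  have hup : Function.Injective up := by
    intro p q hpq
    funext i
    have hi := congrFun hpq i
    simp only [up, Fin.mk.injEq] at hi
    exact Fin.ext hi
  have hcomp : ∀ (g : Equiv.Perm (Fin m)) (p : Fin k → Fin m), ⇑(ι g) ∘ up p = up (⇑g ∘ p) := by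
    intro g p
    funext i
    simp only [Function.comp_apply, up]
    rw [hlt g ⟨p i, lt_of_lt_of_le (p i).2 h⟩ (p i).2]
  refine ⟨fun p' q' => ∑ p : Fin k → Fin m, if p' = up p then
    (∑ q : Fin k → Fin m, if up q = q' then c p q else 0) else 0, fun g => ?_⟩
  simp only [tokenFn]
  rw [Finset.sum_comm]
  refine Finset.sum_congr rfl fun p _ => ?_
  rw [Finset.sum_ite_eq', if_pos (Finset.mem_univ _), hcomp g p, Finset.sum_eq_single (⇑g ∘ p),
    if_pos rfl]
  · intro q _ hq
    exact if_neg fun h' => hq (hup h')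
  · intro h'
    exact absurd (Finset.mem_univ _) h'

/-- **The pair wall, abstract form** (the landed `Negative.card_X_mul_card_Y_le_finrank` with the
target group decoupled): if `(X, Y, Z)` is `k`-token separated in `𝔖ₙ`, `Z ≠ ∅`, and there are points
`pt x y'' ∈ 𝔖_{n'}` and a transport `T` of coefficient tables with `f_{T c}(pt x y'') = f_c(x⁻¹ y'')`
for all tables `c` and all `x ∈ X`, `y'' ∈ Y`, then `|X|·|Y| ≤ dim T_k(𝔖_{n'})`: the transported right
translates `f_{T c₂}`, `c₂` the table of `w ↦ f_{x₀,z₁}(w · y⁻¹ z₁)`, are dual to the points `pt x y''`. -/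
theorem aw_core {n k n' : ℕ} {X Y Z : Finset (Equiv.Perm (Fin n))}
    (h : ∀ x₀ ∈ X, ∀ z₀ ∈ Z, ∃ c : (Fin k → Fin n) → (Fin k → Fin n) → ℂ, ∀ x ∈ X, ∀ y ∈ Y,
      ∀ y' ∈ Y, ∀ z ∈ Z, (∑ p : Fin k → Fin n, c p (⇑(x⁻¹ * y * y'⁻¹ * z) ∘ p)) =
        if x = x₀ ∧ y = y' ∧ z = z₀ then 1 else 0) (hZ : Z.Nonempty)
    (pt : ∀ x ∈ X, ∀ y ∈ Y, Equiv.Perm (Fin n'))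
    (T : ((Fin k → Fin n) → (Fin k → Fin n) → ℂ) → (Fin k → Fin n') → (Fin k → Fin n') → ℂ)
    (hT : ∀ c, ∀ x (hx : x ∈ X), ∀ y (hy : y ∈ Y),
      tokenFn (T c) (pt x hx y hy) = tokenFn c (x⁻¹ * y)) :
    X.card * Y.card ≤ Module.finrank ℂ (tokenSpace n' k) := by
  classical
  obtain ⟨z₁, hz₁⟩ := hZ
  choose c hc using h
  let v : X × Y → tokenSpace n' k := fun i =>
    ⟨tokenFn (T fun p q => c i.1 i.1.2 z₁ hz₁ (⇑((i.2 : Equiv.Perm (Fin n))⁻¹ * z₁)⁻¹ ∘ p)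
      (⇑(1 : Equiv.Perm (Fin n)) ∘ q)), tokenFn_mem_tokenSpace _⟩
  have hli : LinearIndependent ℂ v := by
    refine linearIndependent_of_dualPoints v (fun i => pt i.1 i.1.2 i.2 i.2.2) ?_ ?_
    · rintro ⟨⟨x, hx⟩, ⟨y, hy⟩⟩
      change tokenFn (T fun p q => c x hx z₁ hz₁ (⇑(y⁻¹ * z₁)⁻¹ ∘ p)
        (⇑(1 : Equiv.Perm (Fin n)) ∘ q)) (pt x hx y hy) = 1
      rw [hT _ x hx y hy, ← tokenFn_translate (c x hx z₁ hz₁) 1 (y⁻¹ * z₁) (x⁻¹ * y),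
        show (1 * (x⁻¹ * y) * (y⁻¹ * z₁)) = x⁻¹ * y * y⁻¹ * z₁ by group]
      unfold tokenFn
      rw [hc x hx z₁ hz₁ x hx y hy y hy z₁ hz₁, if_pos ⟨rfl, rfl, rfl⟩]
    · rintro ⟨⟨x, hx⟩, ⟨y, hy⟩⟩ ⟨⟨x₀, hx₀⟩, ⟨y', hy'⟩⟩ hne
      change tokenFn (T fun p q => c x₀ hx₀ z₁ hz₁ (⇑(y'⁻¹ * z₁)⁻¹ ∘ p)
        (⇑(1 : Equiv.Perm (Fin n)) ∘ q)) (pt x hx y hy) = 0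
      rw [hT _ x hx y hy, ← tokenFn_translate (c x₀ hx₀ z₁ hz₁) 1 (y'⁻¹ * z₁) (x⁻¹ * y),
        show (1 * (x⁻¹ * y) * (y'⁻¹ * z₁)) = x⁻¹ * y * y'⁻¹ * z₁ by group]
      unfold tokenFn
      rw [hc x₀ hx₀ z₁ hz₁ x hx y hy y' hy' z₁ hz₁, if_neg]
      rintro ⟨rfl, rfl, -⟩
      exact hne rfl
  have := hli.fintype_card_le_finrank
  rwa [Fintype.card_prod, Fintype.card_coe, Fintype.card_coe] at this

/-- **`stub_alphabetWall`** (registered stub K5 of crux stmt-MatrixMultiplication-7613, line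
`garnir-annihilator`, lead c3 reshape 7; verbatim): the pair wall ON A SUPPORT.  If every element of
`X` and of `Y` fixes all points `≥ n'` (so `X, Y` live in the Young factor `𝔖_{[0,n')} × 1`), `Z ≠ ∅`,
and `(X, Y, Z)` is `k`-token separated in `𝔖ₙ` (hypothesis 4: every target `(x₀, z₀)` has a
coefficient table `c` whose token function `g ↦ ∑ p, c p (g ∘ p)` is `1` on the target products and `0`
on all other quadruple products `x⁻¹ * y * y'⁻¹ * z`), then
`|X|·|Y| ≤ D_k(n') = ∑_{μ ⊢ n', n' - k ≤ μ₁} (f^μ)²`, the level-`k` dimension of the small symmetric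
group `𝔖_{n'}`.  Proof: `aw_core` with, for `0 < n' ≤ n`, the restrictions of the dual points
`x⁻¹ y''` to `[0, n')` (`aw_exists_emb`, third clause) and the pulled-back tables (`aw_pullback`); for
`n ≤ n'`, the extensions by the identity and the pushed-forward tables (`aw_pushforward`); for `n' = 0`,
`X, Y ⊆ {1}` and `(f^∅)² ≥ 1` (`numStandardTableaux_pos_holds`).  Then `dim T_k(𝔖_{n'}) ≤ D_k(n')`
(`LevelGradedCohnUmansTokenWall.finrank_tokenSpace_le`). -/
theorem stub_alphabetWall :
    ∀ (n k n' : ℕ) (X Y Z : Finset (Equiv.Perm (Fin n))),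
      (∀ x ∈ X, ∀ i : Fin n, n' ≤ (i : ℕ) → x i = i) → (∀ y ∈ Y, ∀ i : Fin n, n' ≤ (i : ℕ) → y i = i) →
        Z.Nonempty →
          (∀ x₀ ∈ X, ∀ z₀ ∈ Z, ∃ c : (Fin k → Fin n) → (Fin k → Fin n) → ℂ,
              ∀ x ∈ X, ∀ y ∈ Y, ∀ y' ∈ Y, ∀ z ∈ Z,
                (∑ p : Fin k → Fin n, c p (⇑(x⁻¹ * y * y'⁻¹ * z) ∘ p)) = if x = x₀ ∧ y = y' ∧ z = z₀ then 1 else 0) →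
            X.card * Y.card ≤
              ∑ μ : Nat.Partition n', if n' - k ≤ μ.parts.sup then
                Literature.NumberTheory.DiophantineGeometry.numStandardTableaux μ ^ 2 else 0 := by
  intro n k n' X Y Z hX hY hZ hsep
  by_cases hn : n ≤ n'
  · -- `n ≤ n'`: push the whole configuration forward along `ι : 𝔖ₙ → 𝔖_{n'}`
    obtain ⟨ι, hlt, -, -⟩ := aw_exists_emb hn
    choose T hT using fun c : (Fin k → Fin n) → (Fin k → Fin n) → ℂ => aw_pushforward hn ι hlt c
    exact le_trans (aw_core hsep hZ (fun x _ y _ => ι (x⁻¹ * y)) T fun c x _ y _ => hT c (x⁻¹ * y))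
      (LevelGradedCohnUmansTokenWall.finrank_tokenSpace_le n' k)
  have hn' : n' ≤ n := le_of_not_ge hn
  rcases Nat.eq_zero_or_pos n' with h0 | hpos
  · -- `n' = 0`: `X, Y ⊆ {1}` and the right-hand side is `(f^∅)² ≥ 1`
    subst h0
    have h1 : ∀ S : Finset (Equiv.Perm (Fin n)),
        (∀ x ∈ S, ∀ i : Fin n, 0 ≤ (i : ℕ) → x i = i) → S.card ≤ 1 :=
      fun S hS => Finset.card_le_one.2 fun a ha b hb =>
        Equiv.ext fun i => (hS a ha i (Nat.zero_le _)).trans (hS b hb i (Nat.zero_le _)).symm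
    have hterm : 1 ≤ ∑ μ : Nat.Partition 0,
        (if 0 - k ≤ μ.parts.sup then numStandardTableaux μ ^ 2 else 0) := by
      refine le_trans ?_ (Finset.single_le_sum (f := fun μ : Nat.Partition 0 =>
        if 0 - k ≤ μ.parts.sup then numStandardTableaux μ ^ 2 else 0) (fun μ _ => Nat.zero_le _)
        (Finset.mem_univ (Nat.Partition.indiscrete 0)))
      simp only [Nat.zero_sub, zero_le, if_true]
      exact Nat.one_le_pow _ _ (numStandardTableaux_pos_holds _)
    calc X.card * Y.card ≤ 1 * 1 := Nat.mul_le_mul (h1 X hX) (h1 Y hY)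
      _ = 1 := rfl
      _ ≤ _ := hterm
  · -- `0 < n' ≤ n`: restrict the dual points to `[0, n')` and pull the translates back along `ι`
    obtain ⟨ι, hlt, hge, hlift⟩ := aw_exists_emb hn'
    choose T hT using fun c : (Fin k → Fin n) → (Fin k → Fin n) → ℂ => aw_pullback hn' hpos ι hlt hge c
    choose lf hlf using hlift
    have hw : ∀ x ∈ X, ∀ y ∈ Y, ∀ b : Fin n, n' ≤ (b : ℕ) → (x⁻¹ * y) b = b := by
      intro x hx y hy b hb
      rw [Equiv.Perm.mul_apply, hY y hy b hb, Equiv.Perm.inv_eq_iff_eq]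
      exact (hX x hx b hb).symm
    refine le_trans (aw_core hsep hZ (fun x hx y hy => lf (x⁻¹ * y) (hw x hx y hy)) T
      fun c x hx y hy => ?_) (LevelGradedCohnUmansTokenWall.finrank_tokenSpace_le n' k)
    show tokenFn (T c) (lf (x⁻¹ * y) (hw x hx y hy)) = tokenFn c (x⁻¹ * y)
    rw [← hT c, hlf]

end Summit.MatrixMultiplication.MatrixMultiplication.Theorems.SnLevelDesigns
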